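import Literature.Analysis.Distribution.RaySmearedBoundsCone
import Literature.Analysis.Complex.PolydiscWeightedMeanValue
import Mathlib.Analysis.SpecialFunctions.SmoothTransition
import Mathlib.MeasureTheory.Measure.Haar.NormedSpace
import Mathlib.MeasureTheory.Measure.Lebesgue.Basic
import HarnessLib

/-!
# Ray-wise distributional boundary values force locally uniform polynomial growth at the edge

Topic `Literature/Analysis/Distribution`. The main theorem of the cluster
`RaySmearedBounds` → `RaySmearedBoundsCone` → this file:

* `exists_norm_le_inv_pow_of_ray_bounded` — let `f` be holomorphic on an open `U ⊆ E` containing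
  the tube `{J x + i J y : x ∈ V, y ∈ Γ}` over an open convex cone `Γ` of the finite-dimensional
  real space `V` (additive Haar measure `μ`; a measure-preserving linear isomorphism
  `L : ℝ^N ≃ V` is part of the data). Suppose that **on every ray** `{t η : 0 < t ≤ 1}`, `η ∈ Γ`,
  and for every smooth compactly supported `φ`, the pairings `∫ f(J x + i t J η) φ(x) dμ` are
  bounded (as they are when the distributional limit `t → 0⁺` exists ray by ray). Then `f` has
  **polynomial growth at the edge, locally uniformly**: for every compact `K ⊆ Γ` and radius `R`
  there are `C, r` with `|f(J x + i t J η)| ≤ C t^{-r}` for `‖x‖ ≤ R`, `η ∈ K`, `0 < t < 1`.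

This is the several-variable companion of Hörmander, *The Analysis of Linear Partial Differential
Operators I*, Thm. 3.1.14 (one variable: "if `lim_{y→0} f(· + iy)` exists in `𝒟'ᵏ` then
`|f(z)| ≤ C (Im z)^{-k-1}`"), and the converse of Thm. 3.1.15 (`BoundaryValueLimit`); with a
*ray-wise* hypothesis it is part of Martineau's theory of distributional boundary values
(A. Martineau, *Distributions et valeurs au bord des fonctions holomorphes*, Lisbon 1964; cf.
Schapira, LNM 126, Ch. IV §3). No source states it in exactly this form; it is proved here in four
steps: Banach–Steinhaus on each ray and Baire over the directions (`RaySmearedBounds`), propagation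
to all compact sets of directions by analytic discs (`RaySmearedBoundsCone`, `TubeDiscPropagation`),
and finally — this file — **from smeared to pointwise bounds**: the weighted mean value property
over a polydisc of radius `ρ ≍ t` about `J x + i t J η` (`PolydiscWeightedMeanValue`) writes
`f` there as `(ρ² m_β)^{-N} ∫_{ℝ^N} (∫_V f(J x' + i J y_v) F_v(x') dμ) dv`, whose inner integrals are
pairings with the smooth slices `F_v` of the product bump (`sliceTest`), of `C^m`-norm
`O(ρ^{-m})`; hence `|f| ≤ C ρ^{-N-m}`. [folklore]

## Mathlib / tree

Used: `Real.smoothTransition`, `MeasureTheory.Measure.integral_comp_smul` (scaling of the bump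
mass, `finrank ℝ ℂ = 2`), `Complex.volume_preserving_equiv_real_prod`,
`MeasureTheory.volume_preserving_pi`, `MeasureTheory.measurePreserving_arrowProdEquivProdArrow`
(`ℂ^N ≃ ℝ^N × ℝ^N`), `MeasureTheory.integral_prod_symm`, `Real.volume_pi_closedBall`,
`ContinuousLinearMap.iteratedFDeriv_comp_right`, `iteratedFDeriv_comp_add_right`,
`ContinuousMultilinearMap.norm_compContinuousLinearMap_le`,
`HasCompactSupport.exists_bound_of_continuous`; from the tree
`Literature.Analysis.Complex.integral_pi_radial_smul_eq_smul`,
`Literature.Analysis.Distribution.exists_uniform_smeared_bound`.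
-/

noncomputable section

open MeasureTheory Metric Set Filter ContDiffMapSupportedIn TopologicalSpace Module
open _root_.Complex _root_.Topology
open scoped Distributions NNReal ContDiff

namespace Literature.Analysis.Distribution

/-! ### The radial bump and its mass -/

/-- The **radial profile** `β(t) = smoothTransition(2 - 8t²)`: smooth, `= 1` for `t² ≤ 1/8`,
`= 0` for `|t| ≥ 1/2`, values in `[0, 1]`. [folklore] -/
def bumpProfile (t : ℝ) : ℝ := Real.smoothTransition (2 - 8 * t ^ 2)

/-- `β` is continuous. [folklore] -/
theorem continuous_bumpProfile : Continuous bumpProfile :=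
  Real.smoothTransition.continuous.comp (by fun_prop)

/-- `β(t) = 0` for `|t| ≥ 1/2`. [folklore] -/
theorem bumpProfile_eq_zero {t : ℝ} (ht : 1 / 2 ≤ |t|) : bumpProfile t = 0 := by
  apply Real.smoothTransition.zero_of_nonpos
  have : (1 / 2) ^ 2 ≤ |t| ^ 2 := pow_le_pow_left₀ (by norm_num) ht 2
  rw [sq_abs] at this
  linarith

/-- `β(t) = 1` for `t² ≤ 1/8`. [folklore] -/
theorem bumpProfile_eq_one {t : ℝ} (ht : t ^ 2 ≤ 1 / 8) : bumpProfile t = 1 :=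
  Real.smoothTransition.one_of_one_le (by linarith)

/-- `0 ≤ β ≤ 1`. [folklore] -/
theorem bumpProfile_mem_Icc (t : ℝ) : bumpProfile t ∈ Icc (0 : ℝ) 1 :=
  ⟨Real.smoothTransition.nonneg _, Real.smoothTransition.le_one _⟩

/-- The radial bump on `ℂ` in Cartesian coordinates:
`β(|w|) = smoothTransition(2 - 8(Re w² + Im w²))`. [folklore] -/
theorem bumpProfile_norm (w : ℂ) :
    bumpProfile ‖w‖ = Real.smoothTransition (2 - 8 * (w.re ^ 2 + w.im ^ 2)) := by
  rw [bumpProfile, Complex.sq_norm, Complex.normSq_apply]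
  ring_nf

/-- The **mass** `m_β = ∫_ℂ β(|w|) dA(w)`. [folklore] -/
def bumpMass : ℝ := ∫ w : ℂ, bumpProfile ‖w‖

/-- `β(|·|)` is continuous with compact support. [folklore] -/
theorem hasCompactSupport_bumpProfile_norm : HasCompactSupport fun w : ℂ => bumpProfile ‖w‖ := by
  refine HasCompactSupport.intro (isCompact_closedBall (0 : ℂ) (1 / 2)) fun w hw => ?_
  rw [mem_closedBall_zero_iff, not_le] at hw
  exact bumpProfile_eq_zero (by rw [abs_of_nonneg (norm_nonneg w)]; exact hw.le)

/-- `m_β > 0` (the bump equals `1` near the origin). [folklore] -/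
theorem bumpMass_pos : 0 < bumpMass := by
  have hc : Continuous fun w : ℂ => bumpProfile ‖w‖ := continuous_bumpProfile.comp continuous_norm
  rw [bumpMass, integral_pos_iff_support_of_nonneg (fun w => (bumpProfile_mem_Icc _).1)
    (hc.integrable_of_hasCompactSupport hasCompactSupport_bumpProfile_norm)]
  have hsub : ball (0 : ℂ) (1 / 4) ⊆ Function.support fun w : ℂ => bumpProfile ‖w‖ := by
    intro w hw
    rw [mem_ball_zero_iff] at hw
    rw [Function.mem_support, bumpProfile_eq_one]
    · exact one_ne_zero
    · nlinarith [norm_nonneg w]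
  exact (measure_ball_pos volume (0 : ℂ) (by norm_num)).trans_le (measure_mono hsub)

/-- **Scaling of the mass**: `∫_ℂ β(|w|/ρ) dA = ρ² m_β`. [folklore] -/
theorem integral_bumpProfile_div {ρ : ℝ} (hρ : 0 < ρ) :
    ∫ w : ℂ, bumpProfile (‖w‖ / ρ) = ρ ^ 2 * bumpMass := by
  have h := Measure.integral_comp_smul (μ := (volume : Measure ℂ)) (fun w : ℂ => bumpProfile ‖w‖) ρ⁻¹
  simp only [norm_smul, Real.norm_eq_abs, abs_inv, abs_of_pos hρ, Complex.finrank_real_complex,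
    smul_eq_mul] at h
  have hfun : (fun w : ℂ => bumpProfile (‖w‖ / ρ)) = fun w => bumpProfile (ρ⁻¹ * ‖w‖) := by
    funext w; rw [div_eq_inv_mul]
  rw [bumpMass, hfun, h, inv_pow, abs_inv, inv_inv, abs_of_pos (pow_pos hρ 2)]

/-! ### The product bump on `ℝ^N × ℝ^N` and its slices -/

/-- The **product bump** `Θ(u, v) = ∏ᵢ β(|uᵢ + i vᵢ|)` on `ℝ^N × ℝ^N`, complex-valued. [folklore] -/
def prodBump (N : ℕ) (p : (Fin N → ℝ) × (Fin N → ℝ)) : ℂ :=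
  ((∏ i, bumpProfile ‖(⟨p.1 i, p.2 i⟩ : ℂ)‖ : ℝ) : ℂ)

/-- `Θ` is smooth. [folklore] -/
theorem contDiff_prodBump (N : ℕ) : ContDiff ℝ ∞ (prodBump N) := by
  have h1 : ContDiff ℝ ∞ fun p : (Fin N → ℝ) × (Fin N → ℝ) =>
      ∏ i, bumpProfile ‖(⟨p.1 i, p.2 i⟩ : ℂ)‖ := by
    refine contDiff_prod fun i _ => ?_
    have : (fun p : (Fin N → ℝ) × (Fin N → ℝ) => bumpProfile ‖(⟨p.1 i, p.2 i⟩ : ℂ)‖) =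
        fun p => Real.smoothTransition (2 - 8 * ((p.1 i) ^ 2 + (p.2 i) ^ 2)) := by
      funext p; rw [bumpProfile_norm]
    rw [this]
    exact Real.smoothTransition.contDiff.comp (by fun_prop)
  exact Complex.ofRealCLM.contDiff.comp h1

/-- `Θ(p) = 0` unless `‖p‖ < 1/2` (some coordinate `|uᵢ|` or `|vᵢ|` at least `1/2` kills a factor).
[folklore] -/
theorem prodBump_eq_zero {N : ℕ} {p : (Fin N → ℝ) × (Fin N → ℝ)} (hp : 1 / 2 ≤ ‖p‖) :
    prodBump N p = 0 := by
  unfold prodBump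
  rw [Complex.ofReal_eq_zero]
  rw [Prod.norm_def] at hp
  rcases le_max_iff.1 hp with h | h
  · have h' := not_lt.2 h
    rw [pi_norm_lt_iff (by norm_num : (0 : ℝ) < 1 / 2)] at h'
    push Not at h'
    obtain ⟨i, hi⟩ := h'
    refine Finset.prod_eq_zero (Finset.mem_univ i) (bumpProfile_eq_zero ?_)
    rw [abs_of_nonneg (norm_nonneg _)]
    refine hi.trans ?_
    rw [Real.norm_eq_abs]
    exact Complex.abs_re_le_norm (⟨p.1 i, p.2 i⟩ : ℂ)
  · have h' := not_lt.2 h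
    rw [pi_norm_lt_iff (by norm_num : (0 : ℝ) < 1 / 2)] at h'
    push Not at h'
    obtain ⟨i, hi⟩ := h'
    refine Finset.prod_eq_zero (Finset.mem_univ i) (bumpProfile_eq_zero ?_)
    rw [abs_of_nonneg (norm_nonneg _)]
    refine hi.trans ?_
    rw [Real.norm_eq_abs]
    exact Complex.abs_im_le_norm (⟨p.1 i, p.2 i⟩ : ℂ)

/-- `Θ` has compact support. [folklore] -/
theorem hasCompactSupport_prodBump (N : ℕ) : HasCompactSupport (prodBump N) :=
  HasCompactSupport.intro (isCompact_closedBall 0 (1 / 2)) fun p hp =>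
    prodBump_eq_zero (by rw [mem_closedBall_zero_iff, not_le] at hp; exact hp.le)

/-- **Uniform bounds for the derivatives of `Θ`.** [folklore] -/
theorem exists_bound_iteratedFDeriv_prodBump (N i : ℕ) :
    ∃ C : ℝ, 0 ≤ C ∧ ∀ p, ‖iteratedFDeriv ℝ i (prodBump N) p‖ ≤ C := by
  obtain ⟨C, hC⟩ := ((hasCompactSupport_prodBump N).iteratedFDeriv i).exists_bound_of_continuous
    ((contDiff_prodBump N).continuous_iteratedFDeriv (mod_cast le_top))
  exact ⟨max C 0, le_max_right _ _, fun p => (hC p).trans (le_max_left _ _)⟩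

variable {V : Type*} [NormedAddCommGroup V] [NormedSpace ℝ V]

/-- The **slice test function** `F_v(x) = Θ(ρ⁻¹ L⁻¹(x - x₀), ρ⁻¹ v)`: the real slice, at
imaginary offset `v`, of the product bump of radius `ρ` centred at `x₀` in the coordinates `L`.
[folklore] -/
def sliceTest {N : ℕ} (L : (Fin N → ℝ) ≃L[ℝ] V) (x₀ : V) (ρ : ℝ) (v : Fin N → ℝ) (x : V) : ℂ :=
  prodBump N (ρ⁻¹ • L.symm (x - x₀), ρ⁻¹ • v)

/-- The slice test function is smooth. [folklore] -/
theorem contDiff_sliceTest {N : ℕ} (L : (Fin N → ℝ) ≃L[ℝ] V) (x₀ : V) (ρ : ℝ) (v : Fin N → ℝ) :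
    ContDiff ℝ ∞ (sliceTest L x₀ ρ v) :=
  (contDiff_prodBump N).comp
    (by fun_prop : ContDiff ℝ ∞ fun x : V => (ρ⁻¹ • L.symm (x - x₀), ρ⁻¹ • v))

/-- Support of the slice test function: `F_v(x) ≠ 0 ⟹ ‖L⁻¹(x - x₀)‖ < ρ/2`. [folklore] -/
theorem norm_lt_of_sliceTest_ne_zero {N : ℕ} {L : (Fin N → ℝ) ≃L[ℝ] V} {x₀ : V} {ρ : ℝ}
    (hρ : 0 < ρ) {v : Fin N → ℝ} {x : V} (hx : sliceTest L x₀ ρ v x ≠ 0) :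
    ‖L.symm (x - x₀)‖ < ρ / 2 := by
  by_contra h
  push Not at h
  apply hx
  unfold sliceTest
  apply prodBump_eq_zero
  rw [Prod.norm_def]
  refine le_max_of_le_left ?_
  rw [norm_smul, Real.norm_eq_abs, abs_inv, abs_of_pos hρ, le_inv_mul_iff₀ hρ]
  linarith

/-- **Derivative bounds for the slice test functions**, uniform in the centre and the offset:
`‖Dⁱ F_v(x)‖ ≤ Cᵢ (ρ⁻¹ ‖L⁻¹‖)ⁱ` (chain rule for the affine reparametrisation). [folklore] -/
theorem norm_iteratedFDeriv_sliceTest_le {N : ℕ} (L : (Fin N → ℝ) ≃L[ℝ] V) (i : ℕ) :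
    ∃ C : ℝ, 0 ≤ C ∧ ∀ (x₀ : V) (ρ : ℝ), 0 < ρ → ∀ (v : Fin N → ℝ) (x : V),
      ‖iteratedFDeriv ℝ i (sliceTest L x₀ ρ v) x‖ ≤
        C * (ρ⁻¹ * ‖(L.symm : V →L[ℝ] (Fin N → ℝ))‖) ^ i := by
  obtain ⟨C, hC0, hC⟩ := exists_bound_iteratedFDeriv_prodBump N i
  refine ⟨C, hC0, fun x₀ ρ hρ v x => ?_⟩
  -- the affine reparametrisation `x ↦ (ρ⁻¹ L⁻¹ (x - x₀), ρ⁻¹ v) = Λ x + c`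
  set Λ : V →L[ℝ] (Fin N → ℝ) × (Fin N → ℝ) :=
    (ContinuousLinearMap.inl ℝ (Fin N → ℝ) (Fin N → ℝ)).comp (ρ⁻¹ • (L.symm : V →L[ℝ] (Fin N → ℝ)))
    with hΛ
  set c : (Fin N → ℝ) × (Fin N → ℝ) := (-(ρ⁻¹ • L.symm x₀), ρ⁻¹ • v) with hc
  have hfun : sliceTest L x₀ ρ v = (fun z => prodBump N (z + c)) ∘ Λ := by
    funext x
    simp only [sliceTest, Function.comp_apply, hΛ, hc, ContinuousLinearMap.comp_apply,
      smul_apply, ContinuousLinearMap.inl_apply, Prod.mk_add_mk,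
      ContinuousLinearEquiv.coe_coe, map_add, map_neg, smul_add, smul_neg, zero_add, sub_eq_add_neg]
  have hΛnorm : ‖Λ‖ ≤ ρ⁻¹ * ‖(L.symm : V →L[ℝ] (Fin N → ℝ))‖ := by
    refine ContinuousLinearMap.opNorm_le_bound _ (by positivity) fun x => ?_
    simp only [hΛ, ContinuousLinearMap.comp_apply, ContinuousLinearMap.inl_apply,
      smul_apply, Prod.norm_def, norm_zero,
      norm_smul, Real.norm_eq_abs, abs_inv, abs_of_pos hρ, mul_assoc]
    rw [max_eq_left (by positivity)]
    exact mul_le_mul_of_nonneg_left ((L.symm : V →L[ℝ] (Fin N → ℝ)).le_opNorm x) (by positivity)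
  have hg : ContDiff ℝ ∞ fun z => prodBump N (z + c) := (contDiff_prodBump N).comp (contDiff_id.add contDiff_const)
  rw [hfun, Λ.iteratedFDeriv_comp_right hg x (mod_cast le_top), iteratedFDeriv_comp_add_right]
  calc _ ≤ ‖iteratedFDeriv ℝ i (prodBump N) (Λ x + c)‖ * ∏ _j : Fin i, ‖Λ‖ :=
        ContinuousMultilinearMap.norm_compContinuousLinearMap_le _ _
    _ ≤ C * (ρ⁻¹ * ‖(L.symm : V →L[ℝ] (Fin N → ℝ))‖) ^ i := by
        rw [Finset.prod_const, Finset.card_univ, Fintype.card_fin]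
        exact mul_le_mul (hC _) (pow_le_pow_left₀ (norm_nonneg _) hΛnorm i) (by positivity) hC0

/-- Norm of a dilated point of `ℂ` in Cartesian coordinates. [folklore] -/
theorem norm_mk_inv_mul {ρ : ℝ} (hρ : 0 < ρ) (a b : ℝ) :
    ‖(⟨ρ⁻¹ * a, ρ⁻¹ * b⟩ : ℂ)‖ = ρ⁻¹ * ‖(⟨a, b⟩ : ℂ)‖ := by
  have h : (⟨ρ⁻¹ * a, ρ⁻¹ * b⟩ : ℂ) = (ρ⁻¹ : ℝ) • (⟨a, b⟩ : ℂ) := by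
    apply Complex.ext <;> simp
  rw [h, norm_smul, Real.norm_eq_abs, abs_inv, abs_of_pos hρ]

/-! ### Coordinates: `ℂ^N ≃ ℝ^N × ℝ^N` and the polydisc points as tube points -/

/-- The measurable equivalence `ℂ^N ≃ ℝ^N × ℝ^N`, `w ↦ (Re w, Im w)`. [folklore] -/
def reImEquiv (N : ℕ) : (Fin N → ℂ) ≃ᵐ (Fin N → ℝ) × (Fin N → ℝ) :=
  (MeasurableEquiv.piCongrRight fun _ : Fin N => Complex.measurableEquivRealProd).trans
    (MeasurableEquiv.arrowProdEquivProdArrow ℝ ℝ (Fin N))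

/-- `reImEquiv⁻¹ (u, v) = (uᵢ + i vᵢ)ᵢ`. [folklore] -/
theorem reImEquiv_symm_apply (N : ℕ) (p : (Fin N → ℝ) × (Fin N → ℝ)) :
    (reImEquiv N).symm p = fun i => (⟨p.1 i, p.2 i⟩ : ℂ) := by
  rfl

/-- `reImEquiv` preserves Lebesgue measure. [folklore] -/
theorem measurePreserving_reImEquiv (N : ℕ) :
    MeasurePreserving (reImEquiv N) volume ((volume : Measure (Fin N → ℝ)).prod volume) := by
  have h1 : MeasurePreserving (MeasurableEquiv.piCongrRight fun _ : Fin N =>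
      Complex.measurableEquivRealProd) volume volume :=
    volume_preserving_pi fun _ => Complex.volume_preserving_equiv_real_prod
  have h2 : MeasurePreserving (MeasurableEquiv.arrowProdEquivProdArrow ℝ ℝ (Fin N))
      (volume : Measure (Fin N → ℝ × ℝ)) ((volume : Measure (Fin N → ℝ)).prod volume) :=
    measurePreserving_arrowProdEquivProdArrow ℝ ℝ (Fin N) (fun _ => volume) (fun _ => volume)
  exact h2.comp h1

variable {E : Type*} [NormedAddCommGroup E] [NormedSpace ℂ E]

/-- **Polydisc points along the directions `J(L eᵢ)` are tube points**:
`z₀ + ∑ᵢ wᵢ J(L eᵢ) = J(L(Re w)) + i J(L(Im w)) + z₀`. [folklore] -/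
theorem sum_smul_eq_tubePoint {N : ℕ} (J : V →L[ℝ] E) (L : (Fin N → ℝ) ≃L[ℝ] V) (w : Fin N → ℂ) :
    ∑ i, w i • J (L (Pi.single i 1)) =
      J (L fun i => (w i).re) + (I : ℂ) • J (L fun i => (w i).im) := by
  have hre : (fun i => (w i).re) = ∑ i, (w i).re • (Pi.single i (1 : ℝ) : Fin N → ℝ) := by
    funext j; simp [Finset.sum_apply, Pi.single_apply]
  have him : (fun i => (w i).im) = ∑ i, (w i).im • (Pi.single i (1 : ℝ) : Fin N → ℝ) := by
    funext j; simp [Finset.sum_apply, Pi.single_apply]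
  rw [hre, him, map_sum, map_sum, map_sum, map_sum, Finset.smul_sum, ← Finset.sum_add_distrib]
  refine Finset.sum_congr rfl fun i _ => ?_
  simp only [map_smul]
  rw [← Complex.coe_smul, ← Complex.coe_smul, smul_smul, ← add_smul]
  congr 1
  rw [mul_comm]
  exact (re_add_im (w i)).symm

/-! ### The main theorem -/

variable [MeasurableSpace V] [BorelSpace V] [FiniteDimensional ℝ V]
variable {μ : Measure V} [μ.IsAddHaarMeasure] {J : V →L[ℝ] E} {f : E → ℂ} {U : Set E} {Γ : Set V}

/-- **Ray-wise bounded distributional boundary behaviour implies locally uniform polynomial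
growth at the edge of the tube.** Let `f` be holomorphic on an open `U ⊆ E` containing the tube
`{J x + i J y : y ∈ Γ}` over the open convex cone `Γ`, `μ` an additive Haar measure on `V`,
`L : ℝ^N ≃ V` a measure-preserving linear isomorphism. If for every `η ∈ Γ` and every smooth
compactly supported `φ` the pairings `t ↦ ∫ f(J x + i t J η) φ(x) dμ` are bounded on `(0, 1]`,
then for every compact `K ⊆ Γ` and every `R` there are `C` and `r` with

  `‖f(J x + i t J η)‖ ≤ C t^{-r}`  for `‖x‖ ≤ R`, `η ∈ K`, `0 < t < 1`.

(Several-variable companion of Hörmander, *ALPDO I*, Thm. 3.1.14; see the module docstring.)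
[folklore] -/
theorem exists_norm_le_inv_pow_of_ray_bounded (hU : IsOpen U) (hf : DifferentiableOn ℂ f U)
    (hΓo : IsOpen Γ) (hΓc : Convex ℝ Γ) (hΓcone : ∀ c : ℝ, 0 < c → ∀ y ∈ Γ, c • y ∈ Γ)
    (htube : ∀ x : V, ∀ y ∈ Γ, J x + (I : ℂ) • J y ∈ U)
    {N : ℕ} (L : (Fin N → ℝ) ≃L[ℝ] V) (hL : MeasurePreserving L volume μ)
    (hray : ∀ η ∈ Γ, ∀ φ : V → ℂ, ContDiff ℝ ∞ φ → HasCompactSupport φ →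
      ∃ C : ℝ, ∀ t ∈ Ioc (0 : ℝ) 1, ‖∫ x, f (J x + ((t : ℂ) * I) • J η) * φ x ∂μ‖ ≤ C)
    {K : Set V} (hK : IsCompact K) (hKΓ : K ⊆ Γ) (R : ℝ) :
    ∃ (C : ℝ) (r : ℕ), ∀ x : V, ‖x‖ ≤ R → ∀ η ∈ K, ∀ t : ℝ, 0 < t → t < 1 →
      ‖f (J x + ((t : ℂ) * I) • J η)‖ ≤ C * t⁻¹ ^ r := by
  -- a compact thickening `K̃ ⊆ Γ` of `K`
  obtain ⟨δ, hδ, hδΓ⟩ := hK.exists_cthickening_subset_open hΓo hKΓ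
  set Kt : Set V := cthickening δ K with hKt
  have hKtc : IsCompact Kt := hK.cthickening
  -- the uniform smeared bound over `K̃`
  set R₀ : ℝ := |R| + 1 with hR₀
  have hrayD : ∀ η ∈ Γ, ∀ F : 𝓓_{ballCompacts (R₀ + 1)}(V, ℂ), ∃ C : ℝ, ∀ t ∈ Ioc (0 : ℝ) 1,
      ‖∫ x, f (J x + ((t : ℂ) * I) • J η) * F x ∂μ‖ ≤ C :=
    fun η hη F => hray η hη F F.contDiff F.hasCompactSupport
  obtain ⟨s₀, m, M, hs₀, hsmear⟩ := exists_uniform_smeared_bound hU hf hΓo hΓc hΓcone htube hrayD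
    hKtc hδΓ
  -- constants
  obtain ⟨Cd, hCd0, hCd⟩ : ∃ Cd : ℝ, 0 ≤ Cd ∧ ∀ i ≤ m, ∀ (x₀ : V) (ρ : ℝ), 0 < ρ → ρ ≤ 1 →
      ∀ (v : Fin N → ℝ) (x : V), ‖iteratedFDeriv ℝ i (sliceTest L x₀ ρ v) x‖ ≤ Cd * ρ⁻¹ ^ m := by
    choose C hC0 hC using fun i => norm_iteratedFDeriv_sliceTest_le (V := V) L i
    set A : ℝ := ‖(L.symm : V →L[ℝ] (Fin N → ℝ))‖ + 1 with hA
    refine ⟨(Finset.range (m + 1)).sum C * A ^ m,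
      mul_nonneg (Finset.sum_nonneg fun j _ => hC0 j) (by positivity), fun i hi x₀ ρ hρ hρ1 v x => ?_⟩
    have hCi : C i ≤ (Finset.range (m + 1)).sum C :=
      Finset.single_le_sum (fun j _ => hC0 j) (Finset.mem_range.2 (Nat.lt_succ_of_le hi))
    have hρi : ρ⁻¹ ^ i ≤ ρ⁻¹ ^ m := pow_le_pow_right₀ ((one_le_inv₀ hρ).2 hρ1) hi
    have hAi : ‖(L.symm : V →L[ℝ] (Fin N → ℝ))‖ ^ i ≤ A ^ m :=
      (pow_le_pow_left₀ (norm_nonneg _) (by linarith) i).trans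
        (pow_le_pow_right₀ (by linarith [norm_nonneg (L.symm : V →L[ℝ] (Fin N → ℝ))]) hi)
    calc _ ≤ C i * (ρ⁻¹ * ‖(L.symm : V →L[ℝ] (Fin N → ℝ))‖) ^ i := hC i x₀ ρ hρ v x
      _ = C i * (ρ⁻¹ ^ i * ‖(L.symm : V →L[ℝ] (Fin N → ℝ))‖ ^ i) := by rw [mul_pow]
      _ ≤ (Finset.range (m + 1)).sum C * (ρ⁻¹ ^ m * A ^ m) := by
          refine mul_le_mul hCi (mul_le_mul hρi hAi (by positivity) (by positivity)) (by positivity)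
            (Finset.sum_nonneg fun j _ => hC0 j)
      _ = _ := by ring
  set BL : ℝ := ‖(L : (Fin N → ℝ) →L[ℝ] V)‖ + 1 with hBL
  have hBL0 : 0 < BL := by positivity
  set c₁ : ℝ := min (δ / BL) (1 / BL) with hc₁
  have hc₁0 : 0 < c₁ := by positivity
  have hc₁δ : c₁ * BL ≤ δ :=
    calc c₁ * BL ≤ δ / BL * BL := mul_le_mul_of_nonneg_right (min_le_left _ _) hBL0.le
      _ = δ := div_mul_cancel₀ δ hBL0.ne'
  have hc₁1 : c₁ * BL ≤ 1 :=
    calc c₁ * BL ≤ 1 / BL * BL := mul_le_mul_of_nonneg_right (min_le_right _ _) hBL0.le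
      _ = 1 := div_mul_cancel₀ 1 hBL0.ne'
  set s₁ : ℝ := min s₀ 1 with hs₁
  have hs₁0 : 0 < s₁ := by positivity
  -- the bound on the compact part `t ∈ [s₁, 1]`
  obtain ⟨Cbig, hCbig⟩ : ∃ Cbig : ℝ, ∀ x : V, ‖x‖ ≤ R → ∀ η ∈ K, ∀ t ∈ Icc s₁ 1,
      ‖f (J x + ((t : ℂ) * I) • J η)‖ ≤ Cbig := by
    set T : Set E := (fun p : V × ℝ × V => J p.1 + ((p.2.1 : ℂ) * I) • J p.2.2) ''
      (closedBall (0 : V) R ×ˢ Icc s₁ 1 ×ˢ K) with hT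
    have hTc : IsCompact T :=
      ((isCompact_closedBall 0 R).prod (isCompact_Icc.prod hK)).image (by fun_prop)
    have hTU : T ⊆ U := by
      rintro _ ⟨⟨x, t, η⟩, ⟨-, ht, hη⟩, rfl⟩
      have := htube x (t • η) (hΓcone t (hs₁0.trans_le ht.1) η (hKΓ hη))
      rwa [tubePoint_smul] at this
    obtain ⟨C, hC⟩ := hTc.exists_bound_of_continuousOn (hf.continuousOn.mono hTU)
    exact ⟨C, fun x hx η hη t ht => hC _ ⟨(x, t, η), ⟨mem_closedBall_zero_iff.2 hx, ht, hη⟩, rfl⟩⟩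
  -- the constant
  set Csmall : ℝ := (bumpMass ^ N)⁻¹ * (|M| * Cd) * c₁⁻¹ ^ (N + m) with hCsmall
  refine ⟨max Csmall |Cbig|, N + m, fun x₀ hx₀ η hη t ht0 ht1 => ?_⟩
  have htinv : 1 ≤ t⁻¹ ^ (N + m) := one_le_pow₀ ((one_le_inv₀ ht0).2 ht1.le)
  by_cases hts : s₁ ≤ t
  · -- large `t`: the compact bound
    calc ‖f (J x₀ + ((t : ℂ) * I) • J η)‖ ≤ Cbig := hCbig x₀ hx₀ η hη t ⟨hts, ht1.le⟩
      _ ≤ max Csmall |Cbig| * 1 := by rw [mul_one]; exact (le_abs_self _).trans (le_max_right _ _)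
      _ ≤ max Csmall |Cbig| * t⁻¹ ^ (N + m) :=
          mul_le_mul_of_nonneg_left htinv ((abs_nonneg _).trans (le_max_right _ _))
  · -- small `t`: the polydisc argument
    push Not at hts
    have hts₀ : t ≤ s₀ := hts.le.trans (min_le_left _ _)
    set ρ : ℝ := c₁ * t with hρdef
    have hρ0 : 0 < ρ := by positivity
    have hρ1 : ρ ≤ 1 := by
      rw [hρdef]
      calc c₁ * t ≤ c₁ * BL := by
            refine mul_le_mul_of_nonneg_left (ht1.le.trans ?_) hc₁0.le
            rw [hBL]; linarith [norm_nonneg (L : (Fin N → ℝ) →L[ℝ] V)]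
        _ ≤ 1 := hc₁1
    -- the point and the directions
    set z₀ : E := J x₀ + ((t : ℂ) * I) • J η with hz₀
    set vdir : Fin N → E := fun i => J (L (Pi.single i 1)) with hvdir
    -- norms of `L u` for `u` in a small cube
    have hLu : ∀ u : Fin N → ℝ, ‖L u‖ ≤ (BL - 1) * ‖u‖ := fun u => by
      have := (L : (Fin N → ℝ) →L[ℝ] V).le_opNorm u
      rw [hBL]; simpa using this
    -- the imaginary parts stay over `K̃`: `t η + L v = t k'` with `k' ∈ K̃` for `‖v‖ ≤ ρ`
    have himK : ∀ v : Fin N → ℝ, ‖v‖ ≤ ρ → ∃ k' ∈ Kt, t • η + L v = t • k' := by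
      intro v hv
      refine ⟨η + t⁻¹ • L v, ?_, by rw [smul_add, smul_smul, mul_inv_cancel₀ ht0.ne', one_smul]⟩
      rw [hKt, mem_cthickening_iff]
      refine (Metric.infEDist_le_edist_of_mem hη).trans ?_
      rw [edist_dist, dist_eq_norm, add_sub_cancel_left, norm_smul, Real.norm_eq_abs, abs_inv,
        abs_of_pos ht0]
      apply ENNReal.ofReal_le_ofReal
      rw [inv_mul_le_iff₀ ht0]
      calc ‖L v‖ ≤ (BL - 1) * ‖v‖ := hLu v
        _ ≤ BL * ρ := mul_le_mul (by linarith) hv (norm_nonneg _) hBL0.le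
        _ = (c₁ * BL) * t := by rw [hρdef]; ring
        _ ≤ δ * t := mul_le_mul_of_nonneg_right hc₁δ ht0.le
        _ = t * δ := mul_comm _ _
    -- the closed polydisc lies in `U`
    have hmem : ∀ w : Fin N → ℂ, (∀ i, ‖w i‖ ≤ ρ) → z₀ + ∑ i, w i • vdir i ∈ U := by
      intro w hw
      have hv : ‖(fun i => (w i).im)‖ ≤ ρ := by
        refine (pi_norm_le_iff_of_nonneg hρ0.le).2 fun i => ?_
        exact (abs_im_le_norm (w i)).trans (hw i)
      obtain ⟨k', hk', hk'eq⟩ := himK _ hv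
      have : J x₀ + (I : ℂ) • J (t • η) + (J (L fun i => (w i).re) + (I : ℂ) • J (L fun i => (w i).im)) =
          J (x₀ + L fun i => (w i).re) + (I : ℂ) • J (t • η + L fun i => (w i).im) := by
        simp only [map_add, smul_add]; abel
      simp only [hvdir]
      rw [sum_smul_eq_tubePoint, hz₀, ← tubePoint_smul J x₀ η t, this, hk'eq]
      exact htube _ _ (hΓcone t ht0 k' (hδΓ hk'))
    -- the weighted mean value property over the polydisc
    set b : ℝ → ℝ := fun τ => bumpProfile (τ / ρ) with hb
    have hbc : Continuous b := continuous_bumpProfile.comp (continuous_id.div_const _)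
    have hbR : ∀ τ, ρ / 2 ≤ τ → b τ = 0 := fun τ hτ => by
      refine bumpProfile_eq_zero ?_
      have hτ : 0 < τ := by linarith
      rw [abs_of_pos (div_pos hτ hρ0), le_div_iff₀ hρ0]
      linarith
    have hmv := Literature.Analysis.Complex.integral_pi_radial_smul_eq_smul hbc (half_pos hρ0)
      (half_lt_self hρ0) hbR hf N z₀ vdir hmem
    have hmass : ∫ w : ℂ, b ‖w‖ = ρ ^ 2 * bumpMass := integral_bumpProfile_div hρ0
    rw [hmass] at hmv
    -- so `f z₀ = (ρ² m_β)^{-N} ∫ G`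
    have hρm : 0 < (ρ ^ 2 * bumpMass) ^ N := pow_pos (mul_pos (pow_pos hρ0 2) bumpMass_pos) N
    have hfz₀ : ‖f z₀‖ = ((ρ ^ 2 * bumpMass) ^ N)⁻¹ *
        ‖∫ w : Fin N → ℂ, (∏ i, b ‖w i‖) • f (z₀ + ∑ i, w i • vdir i)‖ := by
      rw [hmv, norm_smul, Real.norm_eq_abs, abs_of_pos hρm, ← mul_assoc, inv_mul_cancel₀ hρm.ne',
        one_mul]
    -- the integral over `ℂ^N` as an iterated integral over `ℝ^N × ℝ^N`
    set G : (Fin N → ℂ) → ℂ := fun w => (∏ i, b ‖w i‖) • f (z₀ + ∑ i, w i • vdir i) with hG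
    have hGint : Integrable G :=
      (Literature.Analysis.Complex.continuous_prod_radial_smul hbc (half_lt_self hρ0) hbR
        hf.continuousOn z₀ vdir hmem).integrable_of_hasCompactSupport
        (Literature.Analysis.Complex.hasCompactSupport_prod_radial_smul (half_pos hρ0).le hbR f z₀ vdir)
    have hΦ := measurePreserving_reImEquiv N
    have hGint' : Integrable (fun p : (Fin N → ℝ) × (Fin N → ℝ) => G ((reImEquiv N).symm p))
        ((volume : Measure (Fin N → ℝ)).prod volume) :=
      ((hΦ.symm _).integrable_comp_emb (MeasurableEquiv.measurableEmbedding _)).2 hGint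
    have hiter : ∫ w, G w = ∫ v : Fin N → ℝ, ∫ u : Fin N → ℝ, G ((reImEquiv N).symm (u, v)) := by
      rw [← (hΦ.symm _).integral_comp', integral_prod_symm _ hGint']
    -- the inner integrals are pairings with the slice test functions
    have hinner : ∀ v : Fin N → ℝ, ∫ u : Fin N → ℝ, G ((reImEquiv N).symm (u, v)) =
        ∫ x, f (J x + (I : ℂ) • J (t • η + L v)) * sliceTest L x₀ ρ v x ∂μ := by
      intro v
      have hGuv : ∀ u, G ((reImEquiv N).symm (u, v)) =
          sliceTest L x₀ ρ v (x₀ + L u) * f (J (x₀ + L u) + (I : ℂ) • J (t • η + L v)) := by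
        intro u
        rw [reImEquiv_symm_apply]
        simp only [hG, hvdir]
        rw [sum_smul_eq_tubePoint, hz₀]
        have hpt : J x₀ + (I : ℂ) • J (t • η) + (J (L fun i => u i) + (I : ℂ) • J (L fun i => v i)) =
            J (x₀ + L u) + (I : ℂ) • J (t • η + L v) := by
          simp only [map_add, smul_add]
          change J x₀ + (I : ℂ) • J (t • η) + (J (L u) + (I : ℂ) • J (L v)) = _
          abel
        rw [← tubePoint_smul, hpt, Complex.real_smul]
        congr 1
        simp only [sliceTest, prodBump, add_sub_cancel_left, ContinuousLinearEquiv.symm_apply_apply, hb]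
        congr 1
        refine Finset.prod_congr rfl fun i _ => ?_
        congr 1
        rw [Pi.smul_apply, Pi.smul_apply, smul_eq_mul, smul_eq_mul, div_eq_inv_mul,
          norm_mk_inv_mul hρ0]
      simp_rw [hGuv]
      have h1 := hL.integral_comp L.toHomeomorph.measurableEmbedding
        (fun x => sliceTest L x₀ ρ v (x₀ + x) * f (J (x₀ + x) + (I : ℂ) • J (t • η + L v)))
      rw [h1, integral_add_left_eq_self (μ := μ)
        (fun x => sliceTest L x₀ ρ v x * f (J x + (I : ℂ) • J (t • η + L v))) x₀]
      congr 1
      funext x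
      ring
    -- the slice test functions as elements of `𝓓_{B̄(0, R₀)}` and their seminorms
    have hsupp : ∀ v : Fin N → ℝ, Function.support (sliceTest L x₀ ρ v) ⊆
        ((ballCompacts R₀ : Compacts V) : Set V) := by
      intro v x hx
      rw [coe_ballCompacts, mem_closedBall_zero_iff]
      have h1 := norm_lt_of_sliceTest_ne_zero hρ0 hx
      have h2 : ‖x - x₀‖ ≤ 1 := by
        have := hLu (L.symm (x - x₀))
        rw [ContinuousLinearEquiv.apply_symm_apply] at this
        calc ‖x - x₀‖ ≤ (BL - 1) * ‖L.symm (x - x₀)‖ := this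
          _ ≤ BL * ρ := mul_le_mul (by linarith) (by linarith) (norm_nonneg _) hBL0.le
          _ ≤ 1 := by
              rw [hρdef]
              calc BL * (c₁ * t) = (c₁ * BL) * t := by ring
                _ ≤ 1 * 1 := mul_le_mul hc₁1 ht1.le ht0.le zero_le_one
                _ = 1 := one_mul _
      calc ‖x‖ = ‖x - x₀ + x₀‖ := by rw [sub_add_cancel]
        _ ≤ ‖x - x₀‖ + ‖x₀‖ := norm_add_le _ _
        _ ≤ 1 + |R| := add_le_add h2 (hx₀.trans (le_abs_self R))
        _ = R₀ := by rw [hR₀]; ring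
    set Fv : (Fin N → ℝ) → 𝓓_{ballCompacts R₀}(V, ℂ) := fun v =>
      ContDiffMapSupportedIn.of_support_subset (contDiff_sliceTest L x₀ ρ v) (hsupp v) with hFv
    have hFv_apply : ∀ v x, Fv v x = sliceTest L x₀ ρ v x := fun v x => rfl
    have hFv_norm : ∀ v, ContDiffMapSupportedIn.supSeminorm ℂ V ℂ ⊤ (ballCompacts R₀) m (Fv v) ≤
        Cd * ρ⁻¹ ^ m := by
      intro v
      refine Seminorm.finset_sup_apply_le (by positivity) fun i hi => ?_
      refine (ContDiffMapSupportedIn.seminorm_top_le_iff ℂ (by positivity) i _).2 fun x _ => ?_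
      exact hCd i (Finset.mem_Iic.1 hi) x₀ ρ hρ0 hρ1 v x
    -- bound for the inner integrals
    have hinner_bound : ∀ v : Fin N → ℝ, ‖∫ u : Fin N → ℝ, G ((reImEquiv N).symm (u, v))‖ ≤
        (closedBall (0 : Fin N → ℝ) (ρ / 2)).indicator (fun _ => |M| * (Cd * ρ⁻¹ ^ m)) v := by
      intro v
      by_cases hv : v ∈ closedBall (0 : Fin N → ℝ) (ρ / 2)
      · rw [indicator_of_mem hv, hinner v]
        have hv' : ‖v‖ ≤ ρ := (mem_closedBall_zero_iff.1 hv).trans (half_le_self hρ0.le)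
        obtain ⟨k', hk', hk'eq⟩ := himK v hv'
        rw [hk'eq]
        have h := hsmear k' hk' t ⟨ht0, hts₀⟩ (Fv v)
        simp only [hFv_apply] at h
        calc _ ≤ M * ContDiffMapSupportedIn.supSeminorm ℂ V ℂ ⊤ (ballCompacts R₀) m (Fv v) := h
          _ ≤ |M| * ContDiffMapSupportedIn.supSeminorm ℂ V ℂ ⊤ (ballCompacts R₀) m (Fv v) :=
              mul_le_mul_of_nonneg_right (le_abs_self M) (apply_nonneg _ _)
          _ ≤ |M| * (Cd * ρ⁻¹ ^ m) := mul_le_mul_of_nonneg_left (hFv_norm v) (abs_nonneg M)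
      · rw [indicator_of_notMem hv]
        have h0 : ∀ u, G ((reImEquiv N).symm (u, v)) = 0 := by
          intro u
          rw [mem_closedBall_zero_iff, pi_norm_le_iff_of_nonneg (half_pos hρ0).le] at hv
          push Not at hv
          obtain ⟨i, hi⟩ := hv
          simp only [hG]
          rw [Literature.Analysis.Complex.prod_radial_eq_zero hbR (i := i) ?_, zero_smul]
          rw [reImEquiv_symm_apply]
          exact hi.le.trans (by simpa using abs_im_le_norm (⟨u i, v i⟩ : ℂ))
        simp [h0]
    -- integrability of the dominating indicator
    have hind : Integrable ((closedBall (0 : Fin N → ℝ) (ρ / 2)).indicator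
        (fun _ => |M| * (Cd * ρ⁻¹ ^ m))) (volume : Measure (Fin N → ℝ)) := by
      refine (integrable_indicator_iff measurableSet_closedBall).2 ?_
      exact integrableOn_const (isCompact_closedBall _ _).measure_lt_top.ne
    have hvol : (volume : Measure (Fin N → ℝ)).real (closedBall (0 : Fin N → ℝ) (ρ / 2)) = ρ ^ N := by
      rw [measureReal_def, Real.volume_pi_closedBall _ (half_pos hρ0).le, Fintype.card_fin,
        ENNReal.toReal_ofReal (by positivity)]
      ring
    -- assembling the estimate
    calc ‖f (J x₀ + ((t : ℂ) * I) • J η)‖ = ‖f z₀‖ := rfl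
      _ = ((ρ ^ 2 * bumpMass) ^ N)⁻¹ * ‖∫ w, G w‖ := hfz₀
      _ = ((ρ ^ 2 * bumpMass) ^ N)⁻¹ *
            ‖∫ v : Fin N → ℝ, ∫ u : Fin N → ℝ, G ((reImEquiv N).symm (u, v))‖ := by rw [hiter]
      _ ≤ ((ρ ^ 2 * bumpMass) ^ N)⁻¹ *
            ∫ v : Fin N → ℝ, ‖∫ u : Fin N → ℝ, G ((reImEquiv N).symm (u, v))‖ :=
          mul_le_mul_of_nonneg_left (norm_integral_le_integral_norm _) (by positivity)
      _ ≤ ((ρ ^ 2 * bumpMass) ^ N)⁻¹ * ∫ v : Fin N → ℝ, (closedBall (0 : Fin N → ℝ) (ρ / 2)).indicator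
            (fun _ => |M| * (Cd * ρ⁻¹ ^ m)) v := by
          refine mul_le_mul_of_nonneg_left ?_ (by positivity)
          exact integral_mono_of_nonneg (ae_of_all _ fun v => norm_nonneg _) hind
            (ae_of_all _ hinner_bound)
      _ = ((ρ ^ 2 * bumpMass) ^ N)⁻¹ * (ρ ^ N * (|M| * (Cd * ρ⁻¹ ^ m))) := by
          rw [integral_indicator_const _ measurableSet_closedBall, hvol, smul_eq_mul]
      _ = Csmall * t⁻¹ ^ (N + m) := by
          rw [hCsmall, hρdef]
          have hm0 : bumpMass ≠ 0 := bumpMass_pos.ne'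
          have hc0 : c₁ ≠ 0 := hc₁0.ne'
          have ht0' : t ≠ 0 := ht0.ne'
          simp only [inv_pow, mul_pow]
          field_simp
          ring
      _ ≤ max Csmall |Cbig| * t⁻¹ ^ (N + m) :=
          mul_le_mul_of_nonneg_right (le_max_left _ _) (by positivity)

/-! ### Ray-wise convergence gives ray-wise boundedness -/

omit [μ.IsAddHaarMeasure] in
/-- **Ray-wise convergence implies ray-wise boundedness.** If the pairing
`t ↦ ∫ f(J x + i t J η) φ(x) dμ` has a limit as `t → 0⁺` (the ray-wise distributional boundary
value), then it is bounded on `t ∈ (0, 1]`: near `0` by the limit, on `[δ, 1]` by continuity of the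
pairing in the height (`continuousOn_slicePairing`). [folklore] -/
theorem exists_ray_bound_of_tendsto [IsFiniteMeasureOnCompacts μ] (hf : ContinuousOn f U)
    (hΓo : IsOpen Γ) (hΓcone : ∀ c : ℝ, 0 < c → ∀ y ∈ Γ, c • y ∈ Γ)
    (htube : ∀ x : V, ∀ y ∈ Γ, J x + (I : ℂ) • J y ∈ U) {η : V} (hη : η ∈ Γ)
    {φ : V → ℂ} (hφ : ContDiff ℝ ∞ φ) (hφc : HasCompactSupport φ) {l : ℂ}
    (h : Tendsto (fun t : ℝ => ∫ x, f (J x + ((t : ℂ) * I) • J η) * φ x ∂μ) (𝓝[>] 0) (𝓝 l)) :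
    ∃ C : ℝ, ∀ t ∈ Ioc (0 : ℝ) 1, ‖∫ x, f (J x + ((t : ℂ) * I) • J η) * φ x ∂μ‖ ≤ C := by
  set g : ℝ → ℂ := fun t => ∫ x, f (J x + ((t : ℂ) * I) • J η) * φ x ∂μ with hg
  -- near `0`
  have hev : ∀ᶠ t in 𝓝[>] (0 : ℝ), ‖g t‖ < ‖l‖ + 1 :=
    h.norm.eventually_lt tendsto_const_nhds (lt_add_one _)
  obtain ⟨δ, hδ, hδsub⟩ := (nhdsGT_basis (0 : ℝ)).mem_iff.1 hev
  -- on `[δ', 1]` by continuity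
  set K₀ : Compacts V := ⟨tsupport φ, hφc⟩ with hK₀
  set F : 𝓓_{K₀}(V, ℂ) := ContDiffMapSupportedIn.of_support_subset hφ (subset_tsupport φ) with hF
  have hFφ : ∀ x, F x = φ x := fun x => rfl
  have hcont : ContinuousOn (fun t : ℝ => slicePairing J f μ K₀ (t • η) F) (Ioi 0) :=
    (continuousOn_slicePairing (μ := μ) hf hΓo htube K₀ F).comp
      (continuous_id.smul continuous_const).continuousOn fun t ht => hΓcone t ht η hη
  have hgt : ∀ t : ℝ, 0 < t → slicePairing J f μ K₀ (t • η) F = g t := by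
    intro t ht
    rw [slicePairing_apply hf (fun x => htube x _ (hΓcone t ht η hη))]
    simp_rw [tubePoint_smul, hFφ]
    rfl
  set δ' : ℝ := min (δ / 2) 1 with hδ'
  have hδ'0 : 0 < δ' := by positivity
  obtain ⟨C₂, hC₂⟩ := (isCompact_Icc (a := δ') (b := 1)).exists_bound_of_continuousOn
    (hcont.mono fun t ht => hδ'0.trans_le ht.1)
  refine ⟨max (‖l‖ + 1) C₂, fun t ht => ?_⟩
  by_cases htδ : t < δ
  · exact (hδsub ⟨ht.1, htδ⟩).le.trans (le_max_left _ _)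
  · push Not at htδ
    have htI : t ∈ Icc δ' 1 := ⟨(min_le_left _ _).trans (by linarith), ht.2⟩
    have h2 := hC₂ t htI
    rw [hgt t ht.1] at h2
    exact h2.trans (le_max_right _ _)

end Literature.Analysis.Distribution
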